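import Mathlib
import Summits.NavierStokesRegularity.NavierStokesRegularity.Theorems.TypeILiouvilleLatticeLocal
import Summits.NavierStokesRegularity.NavierStokesRegularity.Theorems.TypeILiouvilleTypeIliouvilleLOseenGauge

/-!
# TypeILiouvilleLatticeCruxSlice — crux (L) stmt-NavierStokesRegularity-10661 `TypeIliouvilleL`
# ON ITS OWN CLASS: ONE a.e.-lattice-periodic SLICE suffices

Helper for stmt-NavierStokesRegularity-10661 (`--supports`); theorems only, no definitions, no named-fact
hypotheses; closes no item; Navier–Stokes regularity is NOT proved here (leafhand seat of the
EulerZoomLiouville route, LAND-ONLY).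

Sharpening of `TypeILiouvilleLatticeMomentum.liouvilleL_onLatticePeriodic` (all slices a.e. periodic): by the
one-patch determination of print's class (`classP_const_of_locallyLatticePeriodic`) it is enough that ONE slice
`u t₀`, `t₀ < 0`, be a.e. invariant under the three unit translations.

* `liouvilleL_onLatticePeriodicSlice` — hypotheses of `Theses.TypeILiouville.TypeIliouvilleL` VERBATIM
  (`IsBoundedAncientMildSolution 1 u`, a.e.-strongly measurable slices) + ONE `t₀ < 0` with
  `(fun x => u t₀ (x + e_j)) =ᵐ u t₀` (`j = 0,1,2`) ⟹ `∀ t < 0, ∃ b, u t =ᵐ fun _ => b`.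

[cite: KochNadirashviliSereginSverak2009, §1 conjecture (L), §4 p. 8 (arXiv:0709.3599)]; [cite: LemarieRieusset2016, Thm. 9.12 (PDF p. 260)]
-/

noncomputable section
open MeasureTheory Filter Set Function Metric
open scoped Topology
open Literature.Analysis Literature.Analysis.FunctionSpaces Literature.Analysis.FluidPDE
set_option linter.dupNamespace false
namespace Summit.NavierStokesRegularity.NavierStokesRegularity.Theorems.TypeILiouvilleLatticeMomentum

/-- **(L) holds for members with ONE a.e.-lattice-periodic slice.**  A bounded ancient mild solution (duality
form, `ν = 1`) with a.e.-strongly measurable slices, one of whose slices `u t₀` (`t₀ < 0`) is a.e. invariant under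
the three unit translations, is a.e. constant on every slice.  Oseen gauge (`Theorems.oseen_gauge_of_aestronglyMeasurable`)
→ the gauge field's slice `v t₀` is periodic everywhere (measure-preserving translations + continuity) → one-patch
lattice symmetry kills (`classP_const_of_locallyLatticePeriodic`, patch `= univ`). [cite: KochNadirashviliSereginSverak2009, §1 conjecture (L) and §4 p. 8 (arXiv:0709.3599)] -/
theorem liouvilleL_onLatticePeriodicSlice
    (u : ℝ → EuclideanSpace ℝ (Fin 3) → EuclideanSpace ℝ (Fin 3))
    (hu : IsBoundedAncientMildSolution 1 u)
    (hmeas : ∀ t < 0, AEStronglyMeasurable (u t) volume)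
    {t₀ : ℝ} (ht₀ : t₀ < 0)
    (hper : ∀ j : Fin 3, (fun x => u t₀ (x + EuclideanSpace.single j 1)) =ᵐ[volume] u t₀) :
    ∀ t < 0, ∃ b : EuclideanSpace ℝ (Fin 3), u t =ᵐ[volume] fun _ => b := by
  obtain ⟨v, A, c, -, hvc, hvK, hvd, hvm, -, hrep⟩ :=
    Theorems.oseen_gauge_of_aestronglyMeasurable u hu hmeas
  have hslice : Continuous (v t₀) :=
    hvc.comp_continuous (f := fun x : EuclideanSpace ℝ (Fin 3) => (t₀, x)) (by fun_prop)
      fun x => ⟨ht₀, mem_univ _⟩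
  -- a.e. periodicity of `u t₀` passes to `v t₀`, pointwise by continuity
  have hvper : ∀ (j : Fin 3), ∀ y ∈ (univ : Set (EuclideanSpace ℝ (Fin 3))),
      v t₀ (y + EuclideanSpace.single j 1) = v t₀ y := by
    intro j y _
    set e : EuclideanSpace ℝ (Fin 3) := EuclideanSpace.single j 1 with he
    have h1 : (fun x => u t₀ (x + e)) =ᵐ[volume] fun x => v t₀ (x + e - A t₀) + c t₀ :=
      (hrep t₀ ht₀).comp_tendsto (measurePreserving_add_right volume e).quasiMeasurePreserving.tendsto_ae
    have h2 : (fun x => v t₀ (x + e - A t₀)) =ᵐ[volume] fun x => v t₀ (x - A t₀) := by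
      filter_upwards [h1, hper j, hrep t₀ ht₀] with x hx1 hx2 hx3
      have h4 : v t₀ (x + e - A t₀) + c t₀ = v t₀ (x - A t₀) + c t₀ := by rw [← hx1, hx2, hx3]
      exact add_right_cancel h4
    have h3 : (fun x => v t₀ (x + e)) =ᵐ[volume] fun x => v t₀ x := by
      have h5 := h2.comp_tendsto
        (measurePreserving_add_right volume (A t₀)).quasiMeasurePreserving.tendsto_ae
      refine h5.mono fun x hx => ?_
      simp only [Function.comp_apply, add_sub_cancel_right] at hx
      rwa [add_right_comm, add_sub_cancel_right] at hx
    have hcont1 : Continuous fun x => v t₀ (x + e) := hslice.comp (continuous_id.add continuous_const)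
    have heq : (fun x => v t₀ (x + e)) = v t₀ := (Continuous.ae_eq_iff_eq volume hcont1 hslice).1 h3
    exact congr_fun heq y
  -- one-patch lattice symmetry (patch = the whole space) kills
  obtain ⟨b, hb⟩ := classP_const_of_locallyLatticePeriodic hvc hvK hvd hvm ht₀ isOpen_univ univ_nonempty hvper
  intro t ht
  refine ⟨b + c t, ?_⟩
  filter_upwards [hrep t ht] with x hx
  rw [hx, hb t ht]

end Summit.NavierStokesRegularity.NavierStokesRegularity.Theorems.TypeILiouvilleLatticeMomentum

end
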